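import Literature.NumberTheory.LFunctions.SelbergExplicitFormula
import Literature.NumberTheory.LFunctions.ZetaLogDerivRePartialFraction
import Literature.NumberTheory.LFunctions.ZetaZerosReflection
import Literature.NumberTheory.LFunctions.WeilZeroSum
import HarnessLib

/-!
# Selberg's abscissa `σ_{x,t}` and the pointwise estimate of the zero sum (unconditional §14.21)

Topic `Literature/NumberTheory/LFunctions`. Everything in this file is PROVED (definitions with
bodies and theorems; no named facts).

A. Selberg, *Contributions to the theory of the Riemann zeta-function* (1946), removed the
Riemann hypothesis from his approximate formula for `S(t)` (Titchmarsh, Theorem 14.21, proves it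
on RH with `σ₁ = ½ + 1/log x`) by the choice (Goldston, *Notes on pair correlation of zeros and
prime numbers*, (10.17)–(10.18))

  `σ_{x,t} = ½ + 2 max_{ρ ∈ 𝒜} (|β − ½|, 2/log x)`,
  `𝒜 = {ρ = β + iγ : |t − γ| ≤ x^{3|β − ½|}/log x}`   ("the zeros near `t`"),

together with the explicit formula whose zero terms are `x^{ρ−s}(1−x^{ρ−s})²/(ℓ²(s−ρ)³)`
(`SelbergExplicitFormula.lean`, `ℓ = log x`). This file contains the real-variable heart of
the argument: with `δ₁ = σ_{x,t} − ½`, `u = δ₁ℓ ≥ 4`, `s₁ = σ_{x,t} + it`, and the positive weights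
`w_ρ = δ₁/(δ₁² + (t−γ)²)`,

* `Literature.NumberTheory.LFunctions.SelbergSigma.norm_zeroTerm_le` — **every** zero term is
  dominated: `‖zeroTerm ℓ s ρ‖ ≤ ε(u) e^{−(σ−σ_{x,t})ℓ} w_ρ` for `σ ≥ σ_{x,t}`, with
  `ε(u) = 32e^{−u/2}/u² + 5e^{−2u}/u ≤ 3/10` for `u ≥ 4` (near zeros have `|β − ½| ≤ δ₁/2`; far zeros
  have `|t − γ| > x^{3|β−½|}/ℓ ≥ 6|β − ½|`, which is what the cube in the denominator is for);
* `Literature.NumberTheory.LFunctions.SelbergSigma.re_inv_sub_add_re_inv_sub_ge` — the pairing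
  `ρ ↔ 1 − ρ̄`: `Re 1/(s₁−ρ) + Re 1/(s₁−(1−ρ̄)) ≥ (24/25) w_ρ` for every zero, hence
  `H := Σ_ρ m(ρ) Re 1/(s₁−ρ) ≥ (12/25) W`, `W := Σ_ρ m(ρ) w_ρ`
  (`Literature.NumberTheory.LFunctions.SelbergSigma.tsum_re_inv_sub_ge`);
* `Literature.NumberTheory.LFunctions.SelbergSigma.norm_tsum_zeroTerm_le` — the unconditional
  (14.21.2): `‖Σ_ρ m(ρ) zeroTerm ℓ s ρ‖ ≤ ε(u) e^{−(σ−σ_{x,t})ℓ} W(t)` for `σ_{x,t} ≤ Re s`;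
* `Literature.NumberTheory.LFunctions.SelbergSigma.W_le` — with the Hadamard partial fraction
  (`re_neg_logDeriv_zeta_hadamard`) and the explicit formula at `s₁`: the unconditional form of
  Titchmarsh's (14.21.3), `W ≤ 6‖D(s₁)‖ + C log t` (`8 ≤ ℓ ≤ 2 log t`), `D(s) = Σ_{n<x³} Λ_x(n) n^{−s}`.
  The combination of the last two items is the unconditional (14.21.4), used in
  `SelbergApproxPointwise.lean`.

Also: measurability of `t ↦ σ_{x,t}` and the inequality `(σ_{x,t} − ½)^m ≤ (4/ℓ)^m·2^m +
2^m Σ_{ρ near t} |β−½|^m` feeding the moment bounds (`SelbergSigmaXTMoments.lean`).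

## References

* A. Selberg, Arch. Math. Naturvid. 48 (1946) no. 5, §§2–4.
* E. C. Titchmarsh, *The Theory of the Riemann Zeta-Function*, 2nd ed. (1986), §14.21,
  (14.21.1)–(14.21.4) (pp. 346–347 of the held copy). [cite: Titchmarsh1986, §14.21]
* D. A. Goldston, *Notes on pair correlation of zeros and prime numbers*, LMS Lecture Note Ser.
  322 (2005), §10, (10.17)–(10.18).
-/

noncomputable section

open Complex Real MeasureTheory Set Filter Topology
open scoped ComplexConjugate

namespace Literature.NumberTheory.LFunctions

namespace SelbergSigma

/-! ## The near zeros and `σ_{x,t}` -/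

/-- `v(ρ) = |Re ρ − ½|`, the distance of `ρ` from the critical line. [folklore] -/
def dev (ρ : ℂ) : ℝ := |ρ.re - 1 / 2|

/-- The window `x^{3|β−½|}/ℓ = e^{3ℓ v(ρ)}/ℓ` of a zero (`ℓ = log x`), Selberg's (1946) unconditional
device. [cite: Goldston2005, (10.17)–(10.18)] -/
def window (ℓ : ℝ) (ρ : ℂ) : ℝ := Real.exp (3 * ℓ * dev ρ) / ℓ

/-- `ρ` is *near* `t` (belongs to Selberg's `𝒜 = 𝒜(x,t)`): `|t − Im ρ| ≤ x^{3|Re ρ − ½|}/log x`.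
[cite: Goldston2005, (10.17)–(10.18)] -/
def IsNear (ℓ t : ℝ) (ρ : ℂ) : Prop := |t - ρ.im| ≤ window ℓ ρ

/-- `v(ρ)` if `ρ` is near `t`, else `0` (as an indicator in `t`). [folklore] -/
def nearVal (ℓ : ℝ) (ρ : ℂ) (t : ℝ) : ℝ :=
  Set.indicator (Set.Icc (ρ.im - window ℓ ρ) (ρ.im + window ℓ ρ)) (fun _ ↦ dev ρ) t

/-- `V(t) = max {|Re ρ − ½| : ρ a non-trivial zero near t}` (`0` if there is none). [folklore] -/
def V (ℓ t : ℝ) : ℝ :=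
  sSup ((fun ρ : ℂ ↦ nearVal ℓ ρ t) '' RHWave0.riemannZetaNontrivialZeros)

/-- `δ₁(t) = σ_{x,t} − ½ = 2 max(V(t), 2/ℓ)`; Selberg's abscissa is `σ_{x,t} = ½ + delta ℓ t`
(Titchmarsh §14.21 is the RH case `σ₁ = ½ + 1/log x`). [cite: Goldston2005, (10.17)–(10.18)] -/
def delta (ℓ t : ℝ) : ℝ := 2 * max (V ℓ t) (2 / ℓ)

/-- `0 ≤ v(ρ)`. [folklore] -/
theorem dev_nonneg (ρ : ℂ) : 0 ≤ dev ρ := abs_nonneg _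

/-- `v(1 − ρ̄) = v(ρ)`. [folklore] -/
theorem dev_one_sub_conj (ρ : ℂ) : dev (1 - conj ρ) = dev ρ := by
  simp only [dev, sub_re, one_re, conj_re]
  rw [show 1 - ρ.re - 1 / 2 = -(ρ.re - 1 / 2) by ring, abs_neg]

/-- The window of `1 − ρ̄` is that of `ρ`. [folklore] -/
theorem window_one_sub_conj (ℓ : ℝ) (ρ : ℂ) : window ℓ (1 - conj ρ) = window ℓ ρ := by
  rw [window, window, dev_one_sub_conj]

/-- `1 − ρ̄` is near `t` iff `ρ` is. [folklore] -/
theorem isNear_one_sub_conj {ℓ t : ℝ} {ρ : ℂ} : IsNear ℓ t (1 - conj ρ) ↔ IsNear ℓ t ρ := by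
  rw [IsNear, IsNear, window_one_sub_conj, show (1 - conj ρ).im = ρ.im by simp]

/-- A non-trivial zero has `v(ρ) < ½`. [folklore] -/
theorem dev_lt_half {ρ : ℂ} (h : ρ ∈ RHWave0.riemannZetaNontrivialZeros) : dev ρ < 1 / 2 := by
  rw [dev, abs_lt]
  constructor <;>
    linarith [ZetaZeros.riemannZetaNontrivialZeros.re_pos h,
      ZetaZeros.riemannZetaNontrivialZeros.re_lt_one h]

/-- Windows are positive (`ℓ > 0`). [folklore] -/
theorem window_pos {ℓ : ℝ} (hℓ : 0 < ℓ) (ρ : ℂ) : 0 < window ℓ ρ := by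
  unfold window; positivity

/-- The windows of the non-trivial zeros are at most `e^{3ℓ/2}/ℓ`. [folklore] -/
theorem window_le {ℓ : ℝ} (hℓ : 0 < ℓ) {ρ : ℂ} (h : ρ ∈ RHWave0.riemannZetaNontrivialZeros) :
    window ℓ ρ ≤ Real.exp (3 * ℓ / 2) / ℓ := by
  unfold window
  gcongr
  nlinarith [dev_lt_half h]

/-- `nearVal ℓ ρ t = v(ρ)` when `ρ` is near `t`. [folklore] -/
theorem nearVal_of_isNear {ℓ t : ℝ} {ρ : ℂ} (h : IsNear ℓ t ρ) : nearVal ℓ ρ t = dev ρ := by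
  rw [nearVal, Set.indicator_of_mem]
  rw [IsNear, abs_le] at h
  exact ⟨by linarith [h.1, h.2], by linarith [h.1, h.2]⟩

/-- `nearVal ℓ ρ t = 0` when `ρ` is far from `t`. [folklore] -/
theorem nearVal_of_not_isNear {ℓ t : ℝ} {ρ : ℂ} (h : ¬ IsNear ℓ t ρ) : nearVal ℓ ρ t = 0 := by
  rw [nearVal, Set.indicator_of_notMem]
  intro hm
  apply h
  rw [IsNear, abs_le]
  exact ⟨by linarith [hm.1, hm.2], by linarith [hm.1, hm.2]⟩

/-- `0 ≤ nearVal`. [folklore] -/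
theorem nearVal_nonneg (ℓ : ℝ) (ρ : ℂ) (t : ℝ) : 0 ≤ nearVal ℓ ρ t := by
  by_cases h : IsNear ℓ t ρ
  · rw [nearVal_of_isNear h]; exact dev_nonneg ρ
  · rw [nearVal_of_not_isNear h]

/-- `t ↦ nearVal ℓ ρ t` is measurable. [folklore] -/
theorem measurable_nearVal (ℓ : ℝ) (ρ : ℂ) : Measurable (nearVal ℓ ρ) :=
  measurable_const.indicator measurableSet_Icc

/-- Near zeros lie within `e^{3ℓ/2}/ℓ` of `t`. [folklore] -/
theorem abs_sub_im_le_of_isNear {ℓ t : ℝ} (hℓ : 0 < ℓ) {ρ : ℂ}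
    (h : ρ ∈ RHWave0.riemannZetaNontrivialZeros) (hn : IsNear ℓ t ρ) :
    |t - ρ.im| ≤ Real.exp (3 * ℓ / 2) / ℓ :=
  hn.trans (window_le hℓ h)

/-- The zeros near `t` form a finite set. [folklore] -/
theorem finite_near {ℓ : ℝ} (hℓ : 0 < ℓ) (t : ℝ) :
    {ρ ∈ RHWave0.riemannZetaNontrivialZeros | IsNear ℓ t ρ}.Finite := by
  set R : ℝ := Real.exp (3 * ℓ / 2) / ℓ + 2 with hR
  refine (riemannZetaNontrivialZeros_finite_inter_ball (t * I) R).subset ?_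
  rintro ρ ⟨hρ, hn⟩
  refine ⟨hρ, ?_⟩
  rw [Metric.mem_ball, dist_eq_norm]
  have him := abs_sub_im_le_of_isNear hℓ hρ hn
  have h0 := ZetaZeros.riemannZetaNontrivialZeros.re_pos hρ
  have h1 := ZetaZeros.riemannZetaNontrivialZeros.re_lt_one hρ
  have hre : (ρ - t * I).re = ρ.re := by simp
  have himm : (ρ - t * I).im = ρ.im - t := by simp
  calc ‖ρ - t * I‖ ≤ |(ρ - t * I).re| + |(ρ - t * I).im| := Complex.norm_le_abs_re_add_abs_im _
    _ = |ρ.re| + |ρ.im - t| := by rw [hre, himm]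
    _ < R := by
        rw [abs_of_pos h0, abs_sub_comm, hR]
        linarith

/-- The set of values `nearVal ℓ ρ t` over the zeros is finite. [folklore] -/
theorem finite_image_nearVal {ℓ : ℝ} (hℓ : 0 < ℓ) (t : ℝ) :
    ((fun ρ : ℂ ↦ nearVal ℓ ρ t) '' RHWave0.riemannZetaNontrivialZeros).Finite := by
  refine (((finite_near hℓ t).image dev).insert 0).subset ?_
  rintro v ⟨ρ, hρ, rfl⟩
  simp only [Set.mem_insert_iff, Set.mem_image, Set.mem_setOf_eq]
  by_cases hn : IsNear ℓ t ρ
  · right; exact ⟨ρ, ⟨hρ, hn⟩, (nearVal_of_isNear hn).symm⟩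
  · left; exact nearVal_of_not_isNear hn

/-- The set of values `nearVal ℓ ρ t` over the zeros is bounded above. [folklore] -/
theorem bddAbove_image_nearVal {ℓ : ℝ} (hℓ : 0 < ℓ) (t : ℝ) :
    BddAbove ((fun ρ : ℂ ↦ nearVal ℓ ρ t) '' RHWave0.riemannZetaNontrivialZeros) :=
  (finite_image_nearVal hℓ t).bddAbove

/-- `v(ρ) ≤ V(t)` for every zero near `t`. [folklore] -/
theorem dev_le_V {ℓ t : ℝ} (hℓ : 0 < ℓ) {ρ : ℂ} (h : ρ ∈ RHWave0.riemannZetaNontrivialZeros)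
    (hn : IsNear ℓ t ρ) : dev ρ ≤ V ℓ t := by
  rw [← nearVal_of_isNear hn]
  exact le_csSup (bddAbove_image_nearVal hℓ t) ⟨ρ, h, rfl⟩

/-- `V(t)` is `0` or the `v` of a zero near `t`. [folklore] -/
theorem V_eq_zero_or_exists {ℓ : ℝ} (hℓ : 0 < ℓ) (t : ℝ) :
    V ℓ t = 0 ∨ ∃ ρ ∈ RHWave0.riemannZetaNontrivialZeros, IsNear ℓ t ρ ∧ V ℓ t = dev ρ := by
  by_cases hne : ((fun ρ : ℂ ↦ nearVal ℓ ρ t) '' RHWave0.riemannZetaNontrivialZeros).Nonempty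
  · obtain ⟨ρ, hρ, hv⟩ := hne.csSup_mem (finite_image_nearVal hℓ t)
    simp only at hv
    by_cases hn : IsNear ℓ t ρ
    · right
      exact ⟨ρ, hρ, hn, by rw [V, ← hv, nearVal_of_isNear hn]⟩
    · left
      rw [V, ← hv, nearVal_of_not_isNear hn]
  · left
    rw [Set.not_nonempty_iff_eq_empty] at hne
    rw [V, hne, Real.sSup_empty]

/-- `0 ≤ V(t)`. [folklore] -/
theorem V_nonneg {ℓ : ℝ} (hℓ : 0 < ℓ) (t : ℝ) : 0 ≤ V ℓ t := by
  rcases V_eq_zero_or_exists hℓ t with h | ⟨ρ, -, -, h⟩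
  · rw [h]
  · rw [h]; exact dev_nonneg ρ

/-- `V(t) < ½`. [folklore] -/
theorem V_lt_half {ℓ : ℝ} (hℓ : 0 < ℓ) (t : ℝ) : V ℓ t < 1 / 2 := by
  rcases V_eq_zero_or_exists hℓ t with h | ⟨ρ, hρ, -, h⟩
  · rw [h]; norm_num
  · rw [h]; exact dev_lt_half hρ

/-- `V(t)^m ≤ Σ_{ρ ∈ F} v(ρ)^m · 1[ρ near t]` for any finite set `F` of zeros containing the
zeros near `t`. [folklore] -/
theorem V_pow_le_sum {ℓ : ℝ} (hℓ : 0 < ℓ) (t : ℝ) (m : ℕ) (hm : m ≠ 0) (F : Finset ℂ)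
    (hF : ∀ ρ ∈ RHWave0.riemannZetaNontrivialZeros, IsNear ℓ t ρ → ρ ∈ F) :
    V ℓ t ^ m ≤ ∑ ρ ∈ F, nearVal ℓ ρ t ^ m := by
  rcases V_eq_zero_or_exists hℓ t with h | ⟨ρ, hρ, hn, h⟩
  · rw [h, zero_pow hm]
    exact Finset.sum_nonneg fun ρ _ ↦ pow_nonneg (nearVal_nonneg ℓ ρ t) m
  · rw [h, ← nearVal_of_isNear hn]
    exact Finset.single_le_sum (fun ρ _ ↦ pow_nonneg (nearVal_nonneg ℓ ρ t) m) (hF ρ hρ hn)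

/-- `t ↦ V(t)` is measurable (a countable supremum of indicator functions). [folklore] -/
theorem measurable_V (ℓ : ℝ) : Measurable (V ℓ) :=
  Measurable.sSup riemannZetaNontrivialZeros_countable fun ρ _ ↦ measurable_nearVal ℓ ρ

/-- `t ↦ δ₁(t) = σ_{x,t} − ½` is measurable. [folklore] -/
theorem measurable_delta (ℓ : ℝ) : Measurable (delta ℓ) :=
  ((measurable_V ℓ).max measurable_const).const_mul 2

/-- `4/ℓ ≤ δ₁` (so `u = δ₁ℓ ≥ 4`). [folklore] -/
theorem four_div_le_delta (ℓ t : ℝ) : 4 / ℓ ≤ delta ℓ t := by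
  rw [delta]
  have := le_max_right (V ℓ t) (2 / ℓ)
  have e : (4 : ℝ) / ℓ = 2 * (2 / ℓ) := by ring
  linarith

/-- `2V(t) ≤ δ₁(t)`. [folklore] -/
theorem two_mul_V_le_delta (ℓ t : ℝ) : 2 * V ℓ t ≤ delta ℓ t := by
  rw [delta]
  have := le_max_left (V ℓ t) (2 / ℓ)
  linarith

/-- `0 < δ₁`. [folklore] -/
theorem delta_pos {ℓ : ℝ} (hℓ : 0 < ℓ) (t : ℝ) : 0 < delta ℓ t :=
  lt_of_lt_of_le (by positivity) (four_div_le_delta ℓ t)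

/-- `δ₁ < 1` once `ℓ > 4` (so `σ_{x,t} < 3/2`). [folklore] -/
theorem delta_lt_one {ℓ : ℝ} (hℓ : 4 < ℓ) (t : ℝ) : delta ℓ t < 1 := by
  have hℓ0 : 0 < ℓ := by linarith
  rw [delta]
  have h1 : V ℓ t < 1 / 2 := V_lt_half hℓ0 t
  have h2 : 2 / ℓ < 1 / 2 := by rw [div_lt_iff₀ hℓ0]; linarith
  have := max_lt h1 h2
  linarith

/-- `δ₁ ≤ 2V + 4/ℓ`. [folklore] -/
theorem delta_le (ℓ t : ℝ) (hℓ : 0 < ℓ) : delta ℓ t ≤ 2 * V ℓ t + 4 / ℓ := by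
  rw [delta]
  have h1 := V_nonneg hℓ t
  have h2 : 0 ≤ 2 / ℓ := by positivity
  have e : (4 : ℝ) / ℓ = 2 * (2 / ℓ) := by ring
  rcases le_total (V ℓ t) (2 / ℓ) with h | h
  · rw [max_eq_right h]; linarith
  · rw [max_eq_left h]; linarith

/-- **`δ₁(t)^m ≤ 2^m((2/ℓ)^m + Σ_{ρ ∈ F} v(ρ)^m 1[ρ near t])`** — the form in which the moments of
`σ_{x,t} − ½` are bounded by sums over the zeros. [folklore] -/
theorem delta_pow_le {ℓ : ℝ} (hℓ : 0 < ℓ) (t : ℝ) (m : ℕ) (hm : m ≠ 0) (F : Finset ℂ)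
    (hF : ∀ ρ ∈ RHWave0.riemannZetaNontrivialZeros, IsNear ℓ t ρ → ρ ∈ F) :
    delta ℓ t ^ m ≤ (2 : ℝ) ^ m * ((2 / ℓ) ^ m + ∑ ρ ∈ F, nearVal ℓ ρ t ^ m) := by
  have hV := V_nonneg hℓ t
  have hc : 0 ≤ 2 / ℓ := by positivity
  have hsum : 0 ≤ ∑ ρ ∈ F, nearVal ℓ ρ t ^ m :=
    Finset.sum_nonneg fun ρ _ ↦ pow_nonneg (nearVal_nonneg ℓ ρ t) m
  rw [delta, mul_pow]
  refine mul_le_mul_of_nonneg_left ?_ (by positivity)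
  rcases le_total (V ℓ t) (2 / ℓ) with h | h
  · rw [max_eq_right h]
    linarith
  · rw [max_eq_left h]
    have := V_pow_le_sum hℓ t m hm F hF
    have : 0 ≤ (2 / ℓ) ^ m := pow_nonneg hc m
    linarith

/-! ## Geometry of near and far zeros -/

/-- `6w ≤ e^{3w}` for `w ≥ 0` (through `(1+w)³ ≤ e^{3w}`). [folklore] -/
theorem six_mul_le_exp_three_mul {w : ℝ} (hw : 0 ≤ w) : 6 * w ≤ Real.exp (3 * w) := by
  have h1 : 1 + w ≤ Real.exp w := by linarith [Real.add_one_le_exp w]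
  have h3 : (1 + w) ^ 3 ≤ Real.exp (3 * w) := by
    rw [show (3 : ℝ) * w = w + w + w by ring, Real.exp_add, Real.exp_add]
    have h0 : 0 ≤ 1 + w := by linarith
    calc (1 + w) ^ 3 = (1 + w) * (1 + w) * (1 + w) := by ring
      _ ≤ Real.exp w * Real.exp w * Real.exp w := by
          gcongr
  nlinarith [sq_nonneg (1 - 3 / 2 * w), sq_nonneg w, mul_nonneg hw (sq_nonneg w)]

/-- A zero **near** `t` has `|Re ρ − ½| ≤ δ₁/2`. [cite: Titchmarsh1986, §14.21] -/
theorem dev_le_half_delta {ℓ t : ℝ} (hℓ : 0 < ℓ) {ρ : ℂ} (h : ρ ∈ RHWave0.riemannZetaNontrivialZeros)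
    (hn : IsNear ℓ t ρ) : dev ρ ≤ delta ℓ t / 2 := by
  have := dev_le_V hℓ h hn
  have := two_mul_V_le_delta ℓ t
  linarith

/-- A zero **far** from `t` has `e^{3ℓ v(ρ)} < ℓ |t − Im ρ|`. [folklore] -/
theorem exp_lt_of_far {ℓ t : ℝ} (hℓ : 0 < ℓ) {ρ : ℂ} (hn : ¬ IsNear ℓ t ρ) :
    Real.exp (3 * ℓ * dev ρ) < ℓ * |t - ρ.im| := by
  rw [IsNear, not_le, window, div_lt_iff₀ hℓ] at hn
  linarith

/-- A zero **far** from `t` has `6 v(ρ) < |t − Im ρ|`. [folklore] -/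
theorem six_mul_dev_lt_of_far {ℓ t : ℝ} (hℓ : 0 < ℓ) {ρ : ℂ} (hn : ¬ IsNear ℓ t ρ) :
    6 * dev ρ < |t - ρ.im| := by
  have h1 := exp_lt_of_far hℓ hn
  have h2 := six_mul_le_exp_three_mul (w := ℓ * dev ρ) (mul_nonneg hℓ.le (dev_nonneg ρ))
  rw [show 3 * (ℓ * dev ρ) = 3 * ℓ * dev ρ by ring] at h2
  have h3 : ℓ * (6 * dev ρ) < ℓ * |t - ρ.im| := by linarith
  exact lt_of_mul_lt_mul_left h3 hℓ.le

/-- Every zero is near `t` or at distance `> 6 v(ρ)`; in particular (`v ≤ δ₁/2` for near zeros)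
**`v(ρ)² ≤ δ₁²/4` or `36 v(ρ)² ≤ (t − γ)²`**. [folklore] -/
theorem dev_sq_le_or {ℓ t : ℝ} (hℓ : 0 < ℓ) {ρ : ℂ} (h : ρ ∈ RHWave0.riemannZetaNontrivialZeros) :
    dev ρ ^ 2 ≤ delta ℓ t ^ 2 / 4 ∨ 36 * dev ρ ^ 2 ≤ (t - ρ.im) ^ 2 := by
  by_cases hn : IsNear ℓ t ρ
  · left
    have h1 := dev_le_half_delta hℓ h hn
    have h0 := dev_nonneg ρ
    nlinarith
  · right
    have h1 := six_mul_dev_lt_of_far hℓ hn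
    have h0 := dev_nonneg ρ
    nlinarith [abs_nonneg (t - ρ.im), sq_abs (t - ρ.im)]

/-- A zero with `v(ρ) > δ₁/2` is far from `t`: `e^{3ℓv} < ℓ|t−γ|` and `|t − γ| > 6v > 3δ₁`. [folklore] -/
theorem far_of_half_delta_lt {ℓ t : ℝ} (hℓ : 0 < ℓ) {ρ : ℂ} (h : ρ ∈ RHWave0.riemannZetaNontrivialZeros)
    (hv : delta ℓ t / 2 < dev ρ) : ¬ IsNear ℓ t ρ := fun hn ↦ by
  have := dev_le_half_delta hℓ h hn; linarith

/-- **No zero at height `t` lies farther than `δ₁/2` from the critical line**: `ζ(σ + it) ≠ 0`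
for `σ > ½ + δ₁(t)/2` (a zero at height exactly `t` is near `t`). [cite: Titchmarsh1986, §14.21] -/
theorem riemannZeta_ne_zero_of_lt {ℓ t σ : ℝ} (hℓ : 0 < ℓ) (hσ : 1 / 2 + delta ℓ t / 2 < σ) :
    riemannZeta (σ + t * I) ≠ 0 := by
  intro hζ
  have hσ' : 1 / 2 < σ := by linarith [(delta_pos hℓ t).le]
  by_cases h1 : 1 ≤ σ
  · exact riemannZeta_ne_zero_of_one_le_re (s := σ + t * I) (by simpa using h1) hζ
  · have hmem : (σ : ℂ) + t * I ∈ RHWave0.riemannZetaNontrivialZeros :=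
      ZetaZeros.riemannZetaNontrivialZeros.mem_of_re_pos hζ (by simp; linarith)
    have hn : IsNear ℓ t (σ + t * I) := by
      rw [IsNear]; simp only [add_im, Complex.ofReal_im, mul_im, Complex.ofReal_re, Complex.I_im,
        mul_one, Complex.I_re, mul_zero, add_zero, zero_add, sub_self, abs_zero]
      exact (window_pos hℓ _).le
    have hd := dev_le_half_delta hℓ hmem hn
    rw [dev] at hd
    simp only [add_re, Complex.ofReal_re, mul_re, Complex.I_re, mul_zero, Complex.ofReal_im,
      Complex.I_im, mul_one, sub_self, add_zero] at hd
    rw [abs_of_pos (by linarith)] at hd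
    linarith

/-! ## The weights `w_ρ` and the domination of the zero terms (Lemma Z) -/

/-- The positive weight `w_ρ = δ₁/(δ₁² + (t − γ)²)` of a zero `ρ = β + iγ`
(the summand of Titchmarsh's (14.21.3)). [cite: Titchmarsh1986, (14.21.3)] -/
def wt (δ t : ℝ) (ρ : ℂ) : ℝ := δ / (δ ^ 2 + (t - ρ.im) ^ 2)

/-- `0 < w_ρ`. [folklore] -/
theorem wt_pos {δ : ℝ} (hδ : 0 < δ) (t : ℝ) (ρ : ℂ) : 0 < wt δ t ρ := by
  unfold wt; positivity

/-- `w_{1−ρ̄} = w_ρ`. [folklore] -/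
theorem wt_one_sub_conj (δ t : ℝ) (ρ : ℂ) : wt δ t (1 - conj ρ) = wt δ t ρ := by
  rw [wt, wt, show (1 - conj ρ).im = ρ.im by simp]

/-- The size function `ε(u) = 32e^{−u/2}/u² + 5e^{−2u}/u`. [folklore] -/
def eps (u : ℝ) : ℝ := 32 * Real.exp (-(u / 2)) / u ^ 2 + 5 * Real.exp (-(2 * u)) / u

/-- `0 ≤ ε(u)` for `u > 0`. [folklore] -/
theorem eps_nonneg {u : ℝ} (hu : 0 < u) : 0 ≤ eps u := by unfold eps; positivity

/-- `ε(u) ≤ 3/10` for `u ≥ 4`. [folklore] -/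
theorem eps_le {u : ℝ} (hu : 4 ≤ u) : eps u ≤ 3 / 10 := by
  have he : (2.7 : ℝ) < Real.exp 1 := lt_trans (by norm_num) Real.exp_one_gt_d9
  have he2 : (7 : ℝ) ≤ Real.exp 2 := by
    have : Real.exp 2 = Real.exp 1 * Real.exp 1 := by rw [← Real.exp_add]; norm_num
    rw [this]; nlinarith [Real.exp_pos 1]
  have hA : Real.exp (-(u / 2)) ≤ 1 / 7 := by
    refine (Real.exp_le_exp.2 (by linarith : -(u / 2) ≤ -2)).trans ?_
    rw [Real.exp_neg, inv_le_comm₀ (Real.exp_pos _) (by norm_num)]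
    norm_num; exact he2
  have hB : Real.exp (-(2 * u)) ≤ 1 / 2000 := by
    refine (Real.exp_le_exp.2 (by linarith : -(2 * u) ≤ -8)).trans ?_
    rw [Real.exp_neg, inv_le_comm₀ (Real.exp_pos _) (by norm_num)]
    have : Real.exp 8 = (Real.exp 2) ^ 4 := by rw [← Real.exp_nat_mul]; norm_num
    rw [this]
    have h74 : (7 : ℝ) ^ 4 ≤ Real.exp 2 ^ 4 := pow_le_pow_left₀ (by norm_num) he2 4
    norm_num at h74 ⊢; linarith
  have hu2 : 16 ≤ u ^ 2 := by nlinarith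
  unfold eps
  have t1 : 32 * Real.exp (-(u / 2)) / u ^ 2 ≤ 32 * (1 / 7) / 16 := by
    calc 32 * Real.exp (-(u / 2)) / u ^ 2 ≤ 32 * (1 / 7) / u ^ 2 := by gcongr
      _ ≤ 32 * (1 / 7) / 16 := div_le_div_of_nonneg_left (by norm_num) (by norm_num) hu2
  have t2 : 5 * Real.exp (-(2 * u)) / u ≤ 5 * (1 / 2000) / 4 := by
    calc 5 * Real.exp (-(2 * u)) / u ≤ 5 * (1 / 2000) / u := by gcongr
      _ ≤ 5 * (1 / 2000) / 4 := div_le_div_of_nonneg_left (by norm_num) (by norm_num) hu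
  linarith

/-- The modulus of a zero term: `‖x^{ρ−s}(1−x^{ρ−s})²/(ℓ²(s−ρ)³)‖ =
e^{(β−σ)ℓ}‖1−x^{ρ−s}‖²/(ℓ²‖s−ρ‖³)`. [folklore] -/
theorem norm_zeroTerm_eq {ℓ : ℝ} (hℓ : 0 < ℓ) (s ρ : ℂ) :
    ‖SelbergExplicit.zeroTerm ℓ s ρ‖ = Real.exp ((ρ.re - s.re) * ℓ) *
      ‖1 - Complex.exp ((ρ - s) * ℓ)‖ ^ 2 / (‖s - ρ‖ ^ 3 * ℓ ^ 2) := by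
  rw [SelbergExplicit.zeroTerm, norm_div, norm_mul, norm_pow, norm_mul, norm_pow, norm_pow,
    Complex.norm_real, Real.norm_eq_abs, abs_of_pos hℓ, Complex.norm_exp]
  congr 2
  simp [Complex.mul_re]

/-- **Lemma Z, the zeros to the left of `½ + δ₁/2`** (in particular all near zeros): for
`σ ≥ ½ + δ₁`, `s = σ + it`, `u = δ₁ℓ`,
`‖zeroTerm ℓ s ρ‖ ≤ (32e^{−u/2}/u²) e^{−(σ−½−δ₁)ℓ} w_ρ`. [cite: Titchmarsh1986, (14.21.1)] -/
theorem norm_zeroTerm_le_of_re_le {ℓ δ t σ : ℝ} (hℓ : 0 < ℓ) (hδ : 0 < δ) (hu : 4 ≤ δ * ℓ)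
    (hσ : 1 / 2 + δ ≤ σ) {ρ : ℂ} (hβ : ρ.re ≤ 1 / 2 + δ / 2) :
    ‖SelbergExplicit.zeroTerm ℓ (σ + t * I) ρ‖ ≤
      32 * Real.exp (-(δ * ℓ / 2)) / (δ * ℓ) ^ 2 * Real.exp (-((σ - 1 / 2 - δ) * ℓ)) * wt δ t ρ := by
  set s : ℂ := σ + t * I with hs
  have hsre : s.re = σ := by simp [hs]
  have hsim : s.im = t := by simp [hs]
  rw [norm_zeroTerm_eq hℓ, hsre]
  -- the exponential
  have hexp : Real.exp ((ρ.re - σ) * ℓ) ≤ Real.exp (-(δ * ℓ / 2)) * Real.exp (-((σ - 1 / 2 - δ) * ℓ)) := by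
    rw [← Real.exp_add, Real.exp_le_exp]; nlinarith
  have hexp1 : Real.exp ((ρ.re - σ) * ℓ) ≤ 1 := by
    rw [Real.exp_le_one_iff]; nlinarith
  -- `‖1 − x^{ρ−s}‖² ≤ 4`
  have hq : ‖Complex.exp ((ρ - s) * ℓ)‖ ≤ 1 := by
    rw [Complex.norm_exp]; simpa [Complex.mul_re, hsre] using hexp1
  have h14 : ‖(1 : ℂ) - Complex.exp ((ρ - s) * ℓ)‖ ^ 2 ≤ 4 := by
    have : ‖(1 : ℂ) - Complex.exp ((ρ - s) * ℓ)‖ ≤ 2 := by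
      refine (norm_sub_le _ _).trans ?_; rw [norm_one]; linarith
    nlinarith [norm_nonneg ((1 : ℂ) - Complex.exp ((ρ - s) * ℓ))]
  -- `‖s − ρ‖³ ≥ (δ/2)(δ² + d²)/4`
  set d : ℝ := t - ρ.im with hd
  have hreρ : δ / 2 ≤ σ - ρ.re := by linarith
  have hn2 : ‖s - ρ‖ ^ 2 = (σ - ρ.re) ^ 2 + d ^ 2 := by
    rw [Complex.sq_norm, Complex.normSq_apply]; simp [hsre, hsim, hd]; ring
  have hn1 : δ / 2 ≤ ‖s - ρ‖ := by
    have : (σ - ρ.re) ≤ ‖s - ρ‖ := by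
      have := Complex.re_le_norm (s - ρ); simpa [hsre] using this
    linarith
  have hA : (δ ^ 2 + d ^ 2) / 4 ≤ ‖s - ρ‖ ^ 2 := by rw [hn2]; nlinarith
  have hApos : 0 < δ ^ 2 + d ^ 2 := by positivity
  have hn3 : δ / 2 * ((δ ^ 2 + d ^ 2) / 4) ≤ ‖s - ρ‖ ^ 3 := by
    calc δ / 2 * ((δ ^ 2 + d ^ 2) / 4) ≤ ‖s - ρ‖ * ‖s - ρ‖ ^ 2 :=
          mul_le_mul hn1 hA (by positivity) (norm_nonneg _)
      _ = ‖s - ρ‖ ^ 3 := by ring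
  have hn3pos : 0 < ‖s - ρ‖ ^ 3 := lt_of_lt_of_le (by positivity) hn3
  -- assemble
  rw [wt, ← hd, div_le_iff₀ (by positivity)]
  have hu0 : 0 < δ * ℓ := by positivity
  calc Real.exp ((ρ.re - σ) * ℓ) * ‖(1 : ℂ) - Complex.exp ((ρ - s) * ℓ)‖ ^ 2
      ≤ (Real.exp (-(δ * ℓ / 2)) * Real.exp (-((σ - 1 / 2 - δ) * ℓ))) * 4 :=
        mul_le_mul hexp h14 (by positivity) (by positivity)
    _ = 32 * Real.exp (-(δ * ℓ / 2)) / (δ * ℓ) ^ 2 * Real.exp (-((σ - 1 / 2 - δ) * ℓ)) *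
          (δ / (δ ^ 2 + d ^ 2)) * ((δ / 2 * ((δ ^ 2 + d ^ 2) / 4)) * ℓ ^ 2) := by
        field_simp; ring
    _ ≤ 32 * Real.exp (-(δ * ℓ / 2)) / (δ * ℓ) ^ 2 * Real.exp (-((σ - 1 / 2 - δ) * ℓ)) *
          (δ / (δ ^ 2 + d ^ 2)) * (‖s - ρ‖ ^ 3 * ℓ ^ 2) := by
        gcongr

set_option maxHeartbeats 800000 in
/-- **Lemma Z, the zeros to the right of `½ + δ₁/2`** (all far from `t`): for
`σ ≥ ½ + δ₁`, `s = σ + it`, `u = δ₁ℓ ≥ 4`, if `e^{3ℓv} < ℓ|t−γ|` and `|t − γ| > 3δ₁` then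
`‖zeroTerm ℓ s ρ‖ ≤ (5e^{−2u}/u) e^{−(σ−½−δ₁)ℓ} w_ρ` — the cube in `(s−ρ)³` absorbs `x^{3v}`.
[cite: Titchmarsh1986, (14.21.1)] -/
theorem norm_zeroTerm_le_of_lt_re {ℓ δ t σ : ℝ} (hℓ : 0 < ℓ) (hδ : 0 < δ) (hu : 4 ≤ δ * ℓ)
    (hσ : 1 / 2 + δ ≤ σ) {ρ : ℂ} (hβ : 1 / 2 + δ / 2 < ρ.re)
    (hfar : Real.exp (3 * ℓ * dev ρ) < ℓ * |t - ρ.im|) (hd3 : 3 * δ < |t - ρ.im|) :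
    ‖SelbergExplicit.zeroTerm ℓ (σ + t * I) ρ‖ ≤
      5 * Real.exp (-(2 * (δ * ℓ))) / (δ * ℓ) * Real.exp (-((σ - 1 / 2 - δ) * ℓ)) * wt δ t ρ := by
  set s : ℂ := σ + t * I with hs
  have hsre : s.re = σ := by simp [hs]
  have hsim : s.im = t := by simp [hs]
  set v : ℝ := dev ρ with hv
  have hvβ : ρ.re = 1 / 2 + v := by
    rw [hv, dev, abs_of_pos (by linarith)]; ring
  set D : ℝ := |t - ρ.im| with hD
  have hDpos : 0 < D := lt_of_le_of_lt (by positivity) hd3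
  set E : ℝ := Real.exp (-((σ - 1 / 2 - δ) * ℓ)) with hE
  set u : ℝ := δ * ℓ with hudef
  have hu0 : 0 < u := by positivity
  -- `q = x^{β−σ} = e^{vℓ} e^{−(σ−½)ℓ}`, and `e^{vℓ} ≤ ℓD e^{−2vℓ}` with `vℓ > u/2`
  have hvl : u / 2 < v * ℓ := by
    have h' : δ / 2 < v := by linarith
    have h'' := mul_lt_mul_of_pos_right h' hℓ
    rw [hudef]; linarith
  have hq_eq : Real.exp ((ρ.re - σ) * ℓ) = Real.exp (v * ℓ) * (Real.exp (-u) * E) := by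
    rw [hE, ← Real.exp_add, ← Real.exp_add]; congr 1; rw [hvβ, hudef]; ring
  have h3vl : Real.exp (3 * (v * ℓ)) < ℓ * D := by
    rw [show 3 * (v * ℓ) = 3 * ℓ * dev ρ by rw [hv]; ring]; exact hfar
  -- powers of `e^{vℓ}` against `ℓ D`
  have hpow1 : Real.exp (v * ℓ) ≤ ℓ * D * Real.exp (-u) := by
    have : Real.exp (v * ℓ) = Real.exp (3 * (v * ℓ)) * Real.exp (-(2 * (v * ℓ))) := by
      rw [← Real.exp_add]; congr 1; ring
    rw [this]
    have h2 : Real.exp (-(2 * (v * ℓ))) ≤ Real.exp (-u) := Real.exp_le_exp.2 (by linarith)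
    exact mul_le_mul h3vl.le h2 (by positivity) (by positivity)
  have hpow2 : Real.exp (v * ℓ) ^ 2 ≤ ℓ * D * Real.exp (-(u / 2)) := by
    have : Real.exp (v * ℓ) ^ 2 = Real.exp (3 * (v * ℓ)) * Real.exp (-(v * ℓ)) := by
      rw [sq, ← Real.exp_add, ← Real.exp_add]; congr 1; ring
    rw [this]
    have h2 : Real.exp (-(v * ℓ)) ≤ Real.exp (-(u / 2)) := Real.exp_le_exp.2 (by linarith)
    exact mul_le_mul h3vl.le h2 (by positivity) (by positivity)
  have hpow3 : Real.exp (v * ℓ) ^ 3 ≤ ℓ * D := by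
    have : Real.exp (v * ℓ) ^ 3 = Real.exp (3 * (v * ℓ)) := by
      rw [← Real.exp_nat_mul]; norm_num
    rw [this]; exact h3vl.le
  -- the numerator `‖q (1 − Q)²‖ ≤ q + 2q² + q³`, `Q = x^{ρ−s}`, `‖Q‖ = q`
  set q : ℝ := Real.exp ((ρ.re - σ) * ℓ) with hqdef
  have hQ : ‖Complex.exp ((ρ - s) * ℓ)‖ = q := by
    rw [Complex.norm_exp, hqdef]; congr 1; simp [Complex.mul_re, hsre]
  have hnum : q * ‖(1 : ℂ) - Complex.exp ((ρ - s) * ℓ)‖ ^ 2 ≤ q + 2 * q ^ 2 + q ^ 3 := by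
    have h1 : ‖(1 : ℂ) - Complex.exp ((ρ - s) * ℓ)‖ ≤ 1 + q := by
      refine (norm_sub_le _ _).trans ?_; rw [norm_one, hQ]
    have hq0 : 0 ≤ q := (Real.exp_pos _).le
    have h2 : ‖(1 : ℂ) - Complex.exp ((ρ - s) * ℓ)‖ ^ 2 ≤ (1 + q) ^ 2 :=
      pow_le_pow_left₀ (norm_nonneg _) h1 2
    calc q * ‖(1 : ℂ) - Complex.exp ((ρ - s) * ℓ)‖ ^ 2 ≤ q * (1 + q) ^ 2 :=
          mul_le_mul_of_nonneg_left h2 hq0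
      _ = q + 2 * q ^ 2 + q ^ 3 := by ring
  -- `‖s − ρ‖³ ≥ D³`, and `δ² + D² ≤ (10/9) D²`
  have hnD : D ≤ ‖s - ρ‖ := by
    have := Complex.abs_im_le_norm (s - ρ)
    rwa [sub_im, hsim, ← hD] at this
  have hn3 : D ^ 3 ≤ ‖s - ρ‖ ^ 3 := pow_le_pow_left₀ hDpos.le hnD 3
  have hn3pos : 0 < ‖s - ρ‖ ^ 3 := lt_of_lt_of_le (by positivity) hn3
  have hA : δ ^ 2 + (t - ρ.im) ^ 2 ≤ 10 / 9 * D ^ 2 := by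
    have h9 : (3 * δ) ^ 2 < D ^ 2 := pow_lt_pow_left₀ hd3 (by positivity) two_ne_zero
    rw [← sq_abs (t - ρ.im), ← hD]
    nlinarith [h9]
  -- assemble: `‖zeroTerm‖ ≤ (q + 2q² + q³)/(D³ ℓ²) ≤ …`
  rw [norm_zeroTerm_eq hℓ, hsre, wt]
  have hApos : 0 < δ ^ 2 + (t - ρ.im) ^ 2 := by positivity
  have step1 : Real.exp ((ρ.re - σ) * ℓ) * ‖(1 : ℂ) - Complex.exp ((ρ - s) * ℓ)‖ ^ 2 /
      (‖s - ρ‖ ^ 3 * ℓ ^ 2) ≤ (q + 2 * q ^ 2 + q ^ 3) / (D ^ 3 * ℓ ^ 2) := by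
    rw [← hqdef]
    exact div_le_div₀ (by positivity) hnum (by positivity) (by gcongr)
  refine step1.trans ?_
  -- bound each power of `q` : `q^j = e^{jvℓ} e^{-ju} E^j ≤ e^{jvℓ} e^{-ju} E`
  have hE1 : E ≤ 1 := by
    rw [hE, Real.exp_le_one_iff]
    have := mul_nonneg (show 0 ≤ σ - 1 / 2 - δ by linarith) hℓ.le
    linarith
  have hE0 : 0 < E := Real.exp_pos _
  have hq1 : q ≤ ℓ * D * E * Real.exp (-(2 * u)) := by
    rw [hq_eq]
    calc Real.exp (v * ℓ) * (Real.exp (-u) * E) ≤ (ℓ * D * Real.exp (-u)) * (Real.exp (-u) * E) :=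
          mul_le_mul_of_nonneg_right hpow1 (by positivity)
      _ = ℓ * D * E * (Real.exp (-u) * Real.exp (-u)) := by ring
      _ = ℓ * D * E * Real.exp (-(2 * u)) := by rw [← Real.exp_add]; ring_nf
  have hq2 : q ^ 2 ≤ ℓ * D * E * Real.exp (-(5 * u / 2)) := by
    rw [hq_eq, mul_pow, mul_pow]
    have hE2 : E ^ 2 ≤ E := pow_le_of_le_one hE0.le hE1 two_ne_zero
    calc Real.exp (v * ℓ) ^ 2 * (Real.exp (-u) ^ 2 * E ^ 2)
        ≤ (ℓ * D * Real.exp (-(u / 2))) * (Real.exp (-u) ^ 2 * E) := by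
          gcongr
      _ = ℓ * D * E * (Real.exp (-(u / 2)) * (Real.exp (-u) * Real.exp (-u))) := by ring
      _ = ℓ * D * E * Real.exp (-(5 * u / 2)) := by
          rw [← Real.exp_add, ← Real.exp_add]; ring_nf
  have hq3 : q ^ 3 ≤ ℓ * D * E * Real.exp (-(3 * u)) := by
    rw [hq_eq, mul_pow, mul_pow]
    have hE3 : E ^ 3 ≤ E := pow_le_of_le_one hE0.le hE1 (by norm_num)
    calc Real.exp (v * ℓ) ^ 3 * (Real.exp (-u) ^ 3 * E ^ 3)
        ≤ (ℓ * D) * (Real.exp (-u) ^ 3 * E) := by gcongr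
      _ = ℓ * D * E * (Real.exp (-u) ^ 3) := by ring
      _ = ℓ * D * E * Real.exp (-(3 * u)) := by rw [← Real.exp_nat_mul]; ring_nf
  have he1 : Real.exp (-(5 * u / 2)) ≤ Real.exp (-(2 * u)) := Real.exp_le_exp.2 (by linarith)
  have he2 : Real.exp (-(3 * u)) ≤ Real.exp (-(2 * u)) := Real.exp_le_exp.2 (by linarith)
  have hsum : q + 2 * q ^ 2 + q ^ 3 ≤ 4 * (ℓ * D * E * Real.exp (-(2 * u))) := by
    have hLD : 0 ≤ ℓ * D * E := by positivity
    have i1 := mul_le_mul_of_nonneg_left he1 hLD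
    have i2 := mul_le_mul_of_nonneg_left he2 hLD
    linarith
  set A : ℝ := δ ^ 2 + (t - ρ.im) ^ 2 with hAdef
  have hL : 4 * (ℓ * D * E * Real.exp (-(2 * u))) / (D ^ 3 * ℓ ^ 2) =
      4 * (E * Real.exp (-(2 * u))) / (D ^ 2 * ℓ) := by
    rw [div_eq_div_iff (by positivity) (by positivity)]; ring
  have hA0 : A ≠ 0 := hApos.ne'
  have hR : 5 * Real.exp (-(2 * u)) / (δ * ℓ) * E * (δ / A) = 5 * (E * Real.exp (-(2 * u))) / (A * ℓ) := by
    rw [div_mul_eq_mul_div, div_mul_div_comm,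
      div_eq_div_iff (mul_ne_zero (by positivity) hA0) (by positivity)]
    ring
  calc (q + 2 * q ^ 2 + q ^ 3) / (D ^ 3 * ℓ ^ 2) ≤ 4 * (ℓ * D * E * Real.exp (-(2 * u))) / (D ^ 3 * ℓ ^ 2) :=
        div_le_div_of_nonneg_right hsum (by positivity)
    _ = 4 * (E * Real.exp (-(2 * u))) / (D ^ 2 * ℓ) := hL
    _ ≤ 5 * (E * Real.exp (-(2 * u))) / (A * ℓ) := by
        rw [div_le_div_iff₀ (by positivity) (by positivity)]
        have hEe : 0 ≤ E * Real.exp (-(2 * u)) * ℓ := by positivity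
        have h45 : 4 * A ≤ 5 * D ^ 2 := by linarith
        nlinarith [mul_le_mul_of_nonneg_left h45 hEe]
    _ = 5 * Real.exp (-(2 * u)) / (δ * ℓ) * E * (δ / A) := hR.symm

/-- **Lemma Z** (Selberg): for every non-trivial zero `ρ`, every `σ ≥ σ_{x,t} = ½ + δ₁(t)` and
`s = σ + it`, with `u = δ₁ℓ` (`≥ 4`),
`‖x^{ρ−s}(1−x^{ρ−s})²/(ℓ²(s−ρ)³)‖ ≤ ε(u) e^{−(σ−σ_{x,t})ℓ} w_ρ`. [cite: Titchmarsh1986, (14.21.1)–(14.21.2)] -/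
theorem norm_zeroTerm_le {ℓ t σ : ℝ} (hℓ : 0 < ℓ) (hσ : 1 / 2 + delta ℓ t ≤ σ) {ρ : ℂ}
    (h : ρ ∈ RHWave0.riemannZetaNontrivialZeros) :
    ‖SelbergExplicit.zeroTerm ℓ (σ + t * I) ρ‖ ≤
      eps (delta ℓ t * ℓ) * Real.exp (-((σ - 1 / 2 - delta ℓ t) * ℓ)) * wt (delta ℓ t) t ρ := by
  set δ := delta ℓ t with hδ
  have hδ0 : 0 < δ := delta_pos hℓ t
  have hu : 4 ≤ δ * ℓ := by
    have := four_div_le_delta ℓ t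
    rw [← hδ, div_le_iff₀ hℓ] at this; linarith
  have hw0 := (wt_pos hδ0 t ρ).le
  have hE0 := (Real.exp_pos (-((σ - 1 / 2 - δ) * ℓ))).le
  rcases le_or_gt ρ.re (1 / 2 + δ / 2) with hβ | hβ
  · refine (norm_zeroTerm_le_of_re_le hℓ hδ0 hu hσ hβ).trans ?_
    have : 32 * Real.exp (-(δ * ℓ / 2)) / (δ * ℓ) ^ 2 ≤ eps (δ * ℓ) := by
      rw [eps]
      have : 0 ≤ 5 * Real.exp (-(2 * (δ * ℓ))) / (δ * ℓ) := by positivity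
      linarith
    gcongr
  · have hv : δ / 2 < dev ρ := by
      rw [dev, abs_of_pos (by linarith)]; linarith
    have hfar := far_of_half_delta_lt hℓ h hv
    have h1 := exp_lt_of_far hℓ hfar
    have h2 := six_mul_dev_lt_of_far hℓ hfar
    have hd3 : 3 * δ < |t - ρ.im| := by linarith
    refine (norm_zeroTerm_le_of_lt_re hℓ hδ0 hu hσ hβ h1 hd3).trans ?_
    have : 5 * Real.exp (-(2 * (δ * ℓ))) / (δ * ℓ) ≤ eps (δ * ℓ) := by
      rw [eps]
      have : 0 ≤ 32 * Real.exp (-(δ * ℓ / 2)) / (δ * ℓ) ^ 2 := by positivity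
      linarith
    gcongr

/-! ## Summing over the zeros: `W`, the zero sum, and the pairing `ρ ↔ 1 − ρ̄` -/

/-- `w_ρ ≤ K_{δ,t} · 1/(1 + γ²)` — the weights are summable against the multiplicities. [folklore] -/
theorem wt_le_div_one_add_sq {δ : ℝ} (hδ : 0 < δ) (t : ℝ) (ρ : ℂ) :
    wt δ t ρ ≤ δ * max ((1 + 2 * t ^ 2) / δ ^ 2) 2 * (1 / (1 + ρ.im ^ 2)) := by
  rw [wt, mul_one_div, div_le_div_iff₀ (by positivity) (by positivity)]
  set M := max ((1 + 2 * t ^ 2) / δ ^ 2) 2 with hM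
  have h1 : (1 + 2 * t ^ 2) / δ ^ 2 ≤ M := le_max_left _ _
  have h2 : (2 : ℝ) ≤ M := le_max_right _ _
  have h1' : 1 + 2 * t ^ 2 ≤ M * δ ^ 2 := by rwa [div_le_iff₀ (by positivity)] at h1
  have hγ : ρ.im ^ 2 ≤ 2 * (t - ρ.im) ^ 2 + 2 * t ^ 2 := by nlinarith [sq_nonneg (2 * t - ρ.im)]
  have hM0 : 0 ≤ M := le_trans (by norm_num) h2
  calc δ * (1 + ρ.im ^ 2) ≤ δ * ((1 + 2 * t ^ 2) + 2 * (t - ρ.im) ^ 2) :=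
        mul_le_mul_of_nonneg_left (by linarith) hδ.le
    _ ≤ δ * (M * δ ^ 2 + M * (t - ρ.im) ^ 2) :=
        mul_le_mul_of_nonneg_left (by nlinarith [sq_nonneg (t - ρ.im)]) hδ.le
    _ = δ * M * (δ ^ 2 + (t - ρ.im) ^ 2) := by ring

/-- `Σ_ρ m(ρ) w_ρ < ∞`. [folklore] -/
theorem summable_zeroOrder_mul_wt {δ : ℝ} (hδ : 0 < δ) (t : ℝ) :
    Summable fun ρ : RHWave0.riemannZetaNontrivialZeros ↦
      (riemannZetaZeroOrder (ρ : ℂ) : ℝ) * wt δ t ρ := by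
  refine Summable.of_nonneg_of_le (fun ρ ↦ mul_nonneg (ZetaZeroSum.zeroOrder_nonneg ρ) (wt_pos hδ t ρ).le)
    (fun ρ ↦ ?_) (ZetaZeroSum.summable_zeroOrder_div_one_add_sq.mul_left
      (δ * max ((1 + 2 * t ^ 2) / δ ^ 2) 2))
  have := mul_le_mul_of_nonneg_left (wt_le_div_one_add_sq hδ t ρ) (ZetaZeroSum.zeroOrder_nonneg ρ)
  refine this.trans_eq ?_
  ring

/-- **`W(t) = Σ_ρ m(ρ) δ₁/(δ₁² + (t − γ)²)`**, the comparison sum of Titchmarsh's (14.21.3),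
over the non-trivial zeros with multiplicity. [cite: Titchmarsh1986, (14.21.3)] -/
def W (ℓ t : ℝ) : ℝ :=
  ∑' ρ : RHWave0.riemannZetaNontrivialZeros, (riemannZetaZeroOrder (ρ : ℂ) : ℝ) * wt (delta ℓ t) t ρ

/-- `0 ≤ W(t)`. [folklore] -/
theorem W_nonneg (ℓ t : ℝ) (hℓ : 0 < ℓ) : 0 ≤ W ℓ t :=
  tsum_nonneg fun ρ ↦ mul_nonneg (ZetaZeroSum.zeroOrder_nonneg ρ) (wt_pos (delta_pos hℓ t) t ρ).le

/-- **The zero sum is dominated by `W`**: for `σ ≥ σ_{x,t}`, `s = σ + it`, `u = δ₁ℓ`,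
`‖Σ_ρ m(ρ) x^{ρ−s}(1−x^{ρ−s})²/(ℓ²(s−ρ)³)‖ ≤ ε(u) e^{−(σ−σ_{x,t})ℓ} W(t)`, and the sum converges
absolutely. [cite: Titchmarsh1986, (14.21.2)] -/
theorem norm_tsum_zeroTerm_le {ℓ t σ : ℝ} (hℓ : 1 ≤ ℓ) (hσ : 1 / 2 + delta ℓ t ≤ σ) :
    ‖∑' ρ : RHWave0.riemannZetaNontrivialZeros,
        (riemannZetaZeroOrder (ρ : ℂ) : ℂ) * SelbergExplicit.zeroTerm ℓ (σ + t * I) ρ‖ ≤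
      eps (delta ℓ t * ℓ) * Real.exp (-((σ - 1 / 2 - delta ℓ t) * ℓ)) * W ℓ t := by
  have hℓ0 : 0 < ℓ := by linarith
  set δ := delta ℓ t with hδ
  have hδ0 : 0 < δ := delta_pos hℓ0 t
  have hu0 : 0 < δ * ℓ := by positivity
  set c : ℝ := eps (δ * ℓ) * Real.exp (-((σ - 1 / 2 - δ) * ℓ)) with hc
  have hc0 : 0 ≤ c := mul_nonneg (eps_nonneg hu0) (Real.exp_pos _).le
  have hW := (summable_zeroOrder_mul_wt hδ0 t).hasSum.mul_left c
  rw [W, ← hδ]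
  refine tsum_of_norm_bounded hW fun ρ ↦ ?_
  rw [norm_mul, Complex.norm_intCast, abs_of_nonneg (ZetaZeroSum.zeroOrder_nonneg ρ)]
  have h := norm_zeroTerm_le hℓ0 hσ ρ.2
  rw [← hδ] at h
  calc (riemannZetaZeroOrder (ρ : ℂ) : ℝ) * ‖SelbergExplicit.zeroTerm ℓ (σ + t * I) ρ‖
      ≤ (riemannZetaZeroOrder (ρ : ℂ) : ℝ) * (c * wt δ t ρ) := by
        refine mul_le_mul_of_nonneg_left ?_ (ZetaZeroSum.zeroOrder_nonneg ρ)
        rw [hc]; exact h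
    _ = c * ((riemannZetaZeroOrder (ρ : ℂ) : ℝ) * wt δ t ρ) := by ring

/-- Summability of the zero sum for `Re s ≥ σ_{x,t}`. [folklore] -/
theorem summable_zeroTerm {ℓ t σ : ℝ} (hℓ : 1 ≤ ℓ) (hσ : 1 / 2 + delta ℓ t ≤ σ) :
    Summable fun ρ : RHWave0.riemannZetaNontrivialZeros ↦
      (riemannZetaZeroOrder (ρ : ℂ) : ℂ) * SelbergExplicit.zeroTerm ℓ (σ + t * I) ρ := by
  have hℓ0 : 0 < ℓ := by linarith
  set δ := delta ℓ t with hδ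
  have hδ0 : 0 < δ := delta_pos hℓ0 t
  have hu0 : 0 < δ * ℓ := by positivity
  set c : ℝ := eps (δ * ℓ) * Real.exp (-((σ - 1 / 2 - δ) * ℓ)) with hc
  refine Summable.of_norm_bounded ((summable_zeroOrder_mul_wt hδ0 t).mul_left c) fun ρ ↦ ?_
  rw [norm_mul, Complex.norm_intCast, abs_of_nonneg (ZetaZeroSum.zeroOrder_nonneg ρ)]
  have h := norm_zeroTerm_le hℓ0 hσ ρ.2
  rw [← hδ] at h
  calc (riemannZetaZeroOrder (ρ : ℂ) : ℝ) * ‖SelbergExplicit.zeroTerm ℓ (σ + t * I) ρ‖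
      ≤ (riemannZetaZeroOrder (ρ : ℂ) : ℝ) * (c * wt δ t ρ) := by
        refine mul_le_mul_of_nonneg_left ?_ (ZetaZeroSum.zeroOrder_nonneg ρ)
        rw [hc]; exact h
    _ = c * ((riemannZetaZeroOrder (ρ : ℂ) : ℝ) * wt δ t ρ) := by ring

/-! ### The pairing inequality -/

/-- **The pairing inequality.** For `δ > 0` and real `d, e` with `e² ≤ δ²/4` or `36e² ≤ d²`:
`(δ−e)/((δ−e)²+d²) + (δ+e)/((δ+e)²+d²) ≥ (24/25) δ/(δ²+d²)`.
(With `e = β − ½`, `d = t − γ` the left side is `Re 1/(s₁−ρ) + Re 1/(s₁−(1−ρ̄))`; the sum equals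
`2δ(δ² + d² − e²)/(((δ−e)²+d²)((δ+e)²+d²))`.) [folklore] -/
theorem pair_ineq {δ d e : ℝ} (hδ : 0 < δ) (h : e ^ 2 ≤ δ ^ 2 / 4 ∨ 36 * e ^ 2 ≤ d ^ 2) :
    24 / 25 * (δ / (δ ^ 2 + d ^ 2)) ≤
      (δ - e) / ((δ - e) ^ 2 + d ^ 2) + (δ + e) / ((δ + e) ^ 2 + d ^ 2) := by
  have hA : 0 < δ ^ 2 + d ^ 2 := by positivity
  -- the two denominators are positive
  have hDm : 0 < (δ - e) ^ 2 + d ^ 2 := by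
    rcases h with h | h
    · have hb := abs_le_of_sq_le_sq' (show e ^ 2 ≤ (δ / 2) ^ 2 by nlinarith) (by positivity)
      have hde : 0 < δ - e := by linarith [hb.2]
      nlinarith [mul_pos hde hde, sq_nonneg d]
    · nlinarith [sq_nonneg (δ - 37 * e), sq_nonneg d, mul_pos hδ hδ]
  have hDp : 0 < (δ + e) ^ 2 + d ^ 2 := by
    rcases h with h | h
    · have hb := abs_le_of_sq_le_sq' (show e ^ 2 ≤ (δ / 2) ^ 2 by nlinarith) (by positivity)
      have hde : 0 < δ + e := by linarith [hb.1]
      nlinarith [mul_pos hde hde, sq_nonneg d]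
    · nlinarith [sq_nonneg (δ + 37 * e), sq_nonneg d, mul_pos hδ hδ]
  rw [div_add_div _ _ hDm.ne' hDp.ne', mul_div_assoc', div_le_div_iff₀ hA (mul_pos hDm hDp)]
  have hid1 : (δ - e) * ((δ + e) ^ 2 + d ^ 2) + ((δ - e) ^ 2 + d ^ 2) * (δ + e) =
      2 * δ * (δ ^ 2 + d ^ 2 - e ^ 2) := by ring
  have hid2 : ((δ - e) ^ 2 + d ^ 2) * ((δ + e) ^ 2 + d ^ 2) =
      (δ ^ 2 + d ^ 2 + e ^ 2) ^ 2 - 4 * δ ^ 2 * e ^ 2 := by ring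
  rw [hid1, hid2]
  set A := δ ^ 2 + d ^ 2 with hAdef
  -- reduce to `13A² − 49Ae² − 12e⁴ + 48δ²e² ≥ 0`
  suffices hP : 0 ≤ 13 * A ^ 2 - 49 * A * e ^ 2 - 12 * e ^ 4 + 48 * δ ^ 2 * e ^ 2 by
    nlinarith
  rcases h with h | h
  · have h4 : 0 ≤ A - 4 * e ^ 2 := by rw [hAdef]; nlinarith [sq_nonneg d]
    have hfac : 13 * A ^ 2 - 49 * A * e ^ 2 - 12 * e ^ 4 = (A - 4 * e ^ 2) * (13 * A + 3 * e ^ 2) := by ring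
    nlinarith [mul_nonneg h4 (show 0 ≤ 13 * A + 3 * e ^ 2 by positivity), sq_nonneg (δ * e)]
  · have h36 : 0 ≤ A - 36 * e ^ 2 := by rw [hAdef]; nlinarith [sq_nonneg δ]
    have hfac : 13 * A ^ 2 - 49 * A * e ^ 2 - 12 * e ^ 4 =
        13 * A * (A - 36 * e ^ 2) + e ^ 2 * (419 * A - 12 * e ^ 2) := by ring
    have h419 : 0 ≤ 419 * A - 12 * e ^ 2 := by nlinarith [hA.le]
    nlinarith [mul_nonneg (show 0 ≤ 13 * A by positivity) h36, mul_nonneg (sq_nonneg e) h419,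
      sq_nonneg (δ * e)]

/-- `Re 1/(s₁ − ρ)` in coordinates: with `s₁ = ½ + δ + it`, `ρ = β + iγ`, `e = β − ½`,
`Re 1/(s₁−ρ) = (δ − e)/((δ−e)² + (t−γ)²)`. [folklore] -/
theorem re_inv_sub_eq_coord (δ t : ℝ) (ρ : ℂ) :
    (1 / (((1 / 2 + δ : ℝ) : ℂ) + t * I - ρ)).re =
      (δ - (ρ.re - 1 / 2)) / ((δ - (ρ.re - 1 / 2)) ^ 2 + (t - ρ.im) ^ 2) := by
  rw [IsHadamardSeq.re_inv_sub_eq, Complex.sq_norm, Complex.normSq_apply]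
  simp only [sub_re, add_re, Complex.ofReal_re, mul_re, Complex.I_re, mul_zero, Complex.ofReal_im,
    Complex.I_im, mul_one, sub_self, add_zero, sub_im, add_im, mul_im, zero_add]
  congr 1 <;> ring

/-- **The pairing for one zero**: `Re 1/(s₁−ρ) + Re 1/(s₁−(1−ρ̄)) ≥ (24/25) w_ρ` for every
non-trivial zero `ρ` (`s₁ = σ_{x,t} + it`): near zeros have `|β−½| ≤ δ₁/2`, far zeros have
`|t−γ| ≥ 6|β−½|`. [folklore] -/
theorem re_inv_sub_add_re_inv_sub_ge {ℓ t : ℝ} (hℓ : 0 < ℓ) {ρ : ℂ}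
    (h : ρ ∈ RHWave0.riemannZetaNontrivialZeros) :
    24 / 25 * wt (delta ℓ t) t ρ ≤
      (1 / (((1 / 2 + delta ℓ t : ℝ) : ℂ) + t * I - ρ)).re +
        (1 / (((1 / 2 + delta ℓ t : ℝ) : ℂ) + t * I - (1 - conj ρ))).re := by
  set δ := delta ℓ t with hδ
  have hδ0 : 0 < δ := delta_pos hℓ t
  rw [re_inv_sub_eq_coord, re_inv_sub_eq_coord, wt]
  simp only [sub_re, one_re, conj_re, show (1 - conj ρ).im = ρ.im by simp]
  have hor := dev_sq_le_or (ℓ := ℓ) (t := t) hℓ h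
  rw [← hδ, dev, sq_abs] at hor
  have key := pair_ineq (d := t - ρ.im) (e := ρ.re - 1 / 2) hδ0 hor
  convert key using 2; ring

/-- The involution `ρ ↦ 1 − ρ̄` of the non-trivial zeros, as an `Equiv` (for `Equiv.tsum_eq`). This is
the same map as `FordL33.refl`/`FordL33.reflEquiv` of `FordZetaZeroRecipSqSum.lean`, which is not
imported here for weight reasons (that file depends on the numerical verification of RH up to height
101 and the first-zero certificate). [folklore] -/
def reflZero : RHWave0.riemannZetaNontrivialZeros ≃ RHWave0.riemannZetaNontrivialZeros where
  toFun ρ := ⟨1 - conj (ρ : ℂ), ZetaZeros.riemannZetaNontrivialZeros.one_sub_conj_mem ρ.2⟩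
  invFun ρ := ⟨1 - conj (ρ : ℂ), ZetaZeros.riemannZetaNontrivialZeros.one_sub_conj_mem ρ.2⟩
  left_inv ρ := by ext; simp
  right_inv ρ := by ext; simp

/-- `reflZero ρ = 1 − ρ̄`. [folklore] -/
theorem reflZero_apply (ρ : RHWave0.riemannZetaNontrivialZeros) :
    ((reflZero ρ : RHWave0.riemannZetaNontrivialZeros) : ℂ) = 1 - conj (ρ : ℂ) := rfl

/-- `m(1 − ρ̄) = m(ρ)` (functional equation and conjugation; the statement of `FordL33.order_refl`
for `reflZero`, see the remark there on why that file is not imported). [folklore] -/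
theorem zeroOrder_reflZero (ρ : RHWave0.riemannZetaNontrivialZeros) :
    riemannZetaZeroOrder ((reflZero ρ : RHWave0.riemannZetaNontrivialZeros) : ℂ) =
      riemannZetaZeroOrder (ρ : ℂ) := by
  rw [reflZero_apply]
  exact riemannZetaZeroOrder_one_sub_conj (ZetaZeros.riemannZetaNontrivialZeros.re_pos ρ.2)
    (ZetaZeros.riemannZetaNontrivialZeros.re_lt_one ρ.2)

/-- **`H ≥ (12/25) W`**: the Hadamard sum `H = Σ_ρ m(ρ) Re 1/(s₁ − ρ)` at `s₁ = σ_{x,t} + it`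
dominates the positive comparison sum, unconditionally (pair `ρ` with `1 − ρ̄`, which has the same
multiplicity, ordinate and weight). [cite: Titchmarsh1986, (14.21.3)] -/
theorem tsum_re_inv_sub_ge {ℓ t : ℝ} (hℓ : 0 < ℓ)
    (hζ : riemannZeta (((1 / 2 + delta ℓ t : ℝ) : ℂ) + t * I) ≠ 0) :
    12 / 25 * W ℓ t ≤ ∑' ρ : RHWave0.riemannZetaNontrivialZeros,
      (riemannZetaZeroOrder (ρ : ℂ) : ℝ) * (1 / ((((1 / 2 + delta ℓ t : ℝ) : ℂ) + t * I) - ρ)).re := by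
  set s₁ : ℂ := ((1 / 2 + delta ℓ t : ℝ) : ℂ) + t * I with hs₁
  set f : RHWave0.riemannZetaNontrivialZeros → ℝ := fun ρ ↦
    (riemannZetaZeroOrder (ρ : ℂ) : ℝ) * (1 / (s₁ - ρ)).re with hf
  have hfs : Summable f := (summable_norm_zeroOrder_mul_re_inv_sub hζ).of_norm
  have hδ0 := delta_pos hℓ t
  have hws := summable_zeroOrder_mul_wt hδ0 t
  -- `Σ f = Σ f ∘ refl`
  have hrefl : ∑' ρ, f (reflZero ρ) = ∑' ρ, f ρ := Equiv.tsum_eq reflZero f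
  have hfs' : Summable fun ρ ↦ f (reflZero ρ) := (Equiv.summable_iff reflZero).2 hfs
  have h2 : 2 * ∑' ρ, f ρ = ∑' ρ, (f ρ + f (reflZero ρ)) := by
    rw [hfs.tsum_add hfs', hrefl]; ring
  have hle : ∑' ρ : RHWave0.riemannZetaNontrivialZeros,
      (riemannZetaZeroOrder (ρ : ℂ) : ℝ) * (24 / 25 * wt (delta ℓ t) t ρ) ≤
      ∑' ρ, (f ρ + f (reflZero ρ)) := by
    refine (hws.mul_left (24 / 25)).congr (fun ρ ↦ by ring) |>.tsum_le_tsum (fun ρ ↦ ?_) (hfs.add hfs')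
    rw [hf]
    simp only
    rw [zeroOrder_reflZero, reflZero_apply, ← mul_add]
    exact mul_le_mul_of_nonneg_left (re_inv_sub_add_re_inv_sub_ge hℓ ρ.2) (ZetaZeroSum.zeroOrder_nonneg ρ)
  have heq : ∑' ρ : RHWave0.riemannZetaNontrivialZeros,
      (riemannZetaZeroOrder (ρ : ℂ) : ℝ) * (24 / 25 * wt (delta ℓ t) t ρ) = 24 / 25 * W ℓ t := by
    rw [W, ← tsum_mul_left]; exact tsum_congr fun ρ ↦ by ring
  rw [heq, ← h2] at hle
  linarith

/-! ## `W ≤ 6‖D(s₁)‖ + C log t` (Titchmarsh's (14.21.3), unconditionally) -/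

/-- The pole term of the explicit formula at `s₁ = σ_{x,t} + it` is `≤ 4/ℓ²` when `x^{3/2} ≤ t³`
(`ℓ ≤ 2 log t`). [folklore] -/
theorem norm_zeroTerm_one_le {ℓ t δ : ℝ} (hℓ : 0 < ℓ) (ht : 1 ≤ t) (hℓt : ℓ ≤ 2 * Real.log t)
    (hδ0 : 0 ≤ δ) :
    ‖SelbergExplicit.zeroTerm ℓ (((1 / 2 + δ : ℝ) : ℂ) + t * I) 1‖ ≤ 4 / ℓ ^ 2 := by
  set s₁ : ℂ := ((1 / 2 + δ : ℝ) : ℂ) + t * I with hs₁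
  have ht0 : 0 < t := by linarith
  rw [norm_zeroTerm_eq hℓ]
  have hs₁re : s₁.re = 1 / 2 + δ := by simp [hs₁]
  have hre : (1 : ℂ).re - s₁.re = 1 / 2 - δ := by rw [hs₁re, Complex.one_re]; ring
  rw [hre]
  -- `e^{(1/2−δ)ℓ} ≤ e^{ℓ/2} ≤ t`
  have hexp_t : Real.exp (ℓ / 2) ≤ t := by
    have : ℓ / 2 ≤ Real.log t := by linarith
    calc Real.exp (ℓ / 2) ≤ Real.exp (Real.log t) := Real.exp_le_exp.2 this
      _ = t := Real.exp_log ht0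
  have h1 : Real.exp ((1 / 2 - δ) * ℓ) ≤ Real.exp (ℓ / 2) :=
    Real.exp_le_exp.2 (by have := mul_nonneg hδ0 hℓ.le; linarith)
  have hq : ‖Complex.exp ((1 - s₁) * ℓ)‖ ≤ Real.exp (ℓ / 2) := by
    rw [Complex.norm_exp]
    refine Real.exp_le_exp.2 ?_
    have : ((1 - s₁) * (ℓ : ℂ)).re = (1 / 2 - δ) * ℓ := by
      rw [Complex.mul_re, Complex.sub_re, Complex.one_re, hs₁re, Complex.ofReal_re, Complex.ofReal_im,
        mul_zero, sub_zero]; ring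
    rw [this]
    have := mul_nonneg hδ0 hℓ.le; linarith
  have h2 : ‖(1 : ℂ) - Complex.exp ((1 - s₁) * ℓ)‖ ^ 2 ≤ 4 * Real.exp (ℓ / 2) ^ 2 := by
    have h1e : 1 ≤ Real.exp (ℓ / 2) := Real.one_le_exp (by positivity)
    have : ‖(1 : ℂ) - Complex.exp ((1 - s₁) * ℓ)‖ ≤ 2 * Real.exp (ℓ / 2) := by
      refine (norm_sub_le _ _).trans ?_; rw [norm_one]; linarith
    nlinarith [norm_nonneg ((1 : ℂ) - Complex.exp ((1 - s₁) * ℓ))]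
  have hn1 : t ≤ ‖s₁ - 1‖ := by
    have := Complex.abs_im_le_norm (s₁ - 1)
    have him : (s₁ - 1).im = t := by simp [hs₁]
    rw [him, abs_of_pos ht0] at this
    exact this
  have h3 : t ^ 3 ≤ ‖s₁ - 1‖ ^ 3 := pow_le_pow_left₀ ht0.le hn1 3
  have h3pos : 0 < ‖s₁ - 1‖ ^ 3 := lt_of_lt_of_le (by positivity) h3
  rw [div_le_div_iff₀ (by positivity) (by positivity)]
  have het : Real.exp (ℓ / 2) ≤ ‖s₁ - 1‖ := hexp_t.trans hn1
  calc Real.exp ((1 / 2 - δ) * ℓ) * ‖(1 : ℂ) - Complex.exp ((1 - s₁) * ℓ)‖ ^ 2 * ℓ ^ 2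
      ≤ Real.exp (ℓ / 2) * (4 * Real.exp (ℓ / 2) ^ 2) * ℓ ^ 2 := by gcongr
    _ = 4 * Real.exp (ℓ / 2) ^ 3 * ℓ ^ 2 := by ring
    _ ≤ 4 * ‖s₁ - 1‖ ^ 3 * ℓ ^ 2 := by gcongr
    _ = 4 * (‖s₁ - 1‖ ^ 3 * ℓ ^ 2) := by ring

/-- **Titchmarsh's (14.21.3) without the Riemann hypothesis** (Selberg 1946): there is an
absolute constant `C` such that for `ℓ ≥ 8`, `ℓ ≤ 2 log t` (i.e. `x ≤ t^{1/…}` with `x = e^ℓ ≥ e⁸`),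
`W(t) = Σ_ρ m(ρ) δ₁/(δ₁² + (t−γ)²) ≤ 6 ‖Σ_{n<x³} Λ_x(n) n^{−σ_{x,t}−it}‖ + C log t`.
Proof: `(12/25)W ≤ H = Re ζ'/ζ(s₁) + Re 1/(s₁−1) − ½log π + ½Re ψ(s₁/2+1)` (pairing and the
Hadamard partial fraction), `Re ζ'/ζ(s₁) ≤ ‖D(s₁)‖ + ε(u)W + O(log t)` (explicit formula and
Lemma Z), `ε(u) ≤ 3/10`. [cite: Titchmarsh1986, (14.21.3)] -/
theorem W_le : ∃ C : ℝ, 0 < C ∧ ∀ ℓ t : ℝ, 8 ≤ ℓ → 0 < t → ℓ ≤ 2 * Real.log t →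
    W ℓ t ≤ 6 * ‖fordK (SelbergExplicit.smoothing ℓ) (((1 / 2 + delta ℓ t : ℝ) : ℂ) + t * I)‖ +
      C * Real.log t := by
  obtain ⟨CJ, hCJ0, hCJ⟩ := SelbergExplicit.norm_remainder_le
  refine ⟨6 * (3 * CJ + 3), by positivity, fun ℓ t hℓ8 ht0 hℓt ↦ ?_⟩
  have hℓ0 : 0 < ℓ := by linarith
  have hℓ1 : 1 ≤ ℓ := by linarith
  have hlogt : 4 ≤ Real.log t := by linarith
  have ht4 : 4 ≤ t := by
    have h54 : Real.exp 4 ≤ t := by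
      calc Real.exp 4 ≤ Real.exp (Real.log t) := Real.exp_le_exp.2 hlogt
        _ = t := Real.exp_log ht0
    have : (4 : ℝ) + 1 ≤ Real.exp 4 := Real.add_one_le_exp (4 : ℝ)
    linarith
  have ht1 : 1 < t := by linarith
  set δ := delta ℓ t with hδ
  have hδ0 : 0 < δ := delta_pos hℓ0 t
  have hδ1 : δ < 1 := delta_lt_one (by linarith) t
  have hu : 4 ≤ δ * ℓ := by
    have := four_div_le_delta ℓ t; rw [← hδ, div_le_iff₀ hℓ0] at this; linarith
  set s₁ : ℂ := ((1 / 2 + δ : ℝ) : ℂ) + t * I with hs₁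
  have hs₁re : s₁.re = 1 / 2 + δ := by simp [hs₁]
  have hs₁im : s₁.im = t := by simp [hs₁]
  have hζ : riemannZeta s₁ ≠ 0 :=
    riemannZeta_ne_zero_of_lt (ℓ := ℓ) (t := t) (σ := 1 / 2 + δ) hℓ0 (by rw [← hδ]; linarith)
  have hs₁0 : s₁ ≠ 0 := fun h ↦ by
    have := congrArg Complex.im h; rw [hs₁im, Complex.zero_im] at this; linarith
  have hs₁1 : s₁ ≠ 1 := fun h ↦ by
    have := congrArg Complex.im h; rw [hs₁im, Complex.one_im] at this; linarith
  -- (1) pairing: `12/25 W ≤ H`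
  have hH : 12 / 25 * W ℓ t ≤ ∑' ρ : RHWave0.riemannZetaNontrivialZeros,
      (riemannZetaZeroOrder (ρ : ℂ) : ℝ) * (1 / (s₁ - ρ)).re :=
    tsum_re_inv_sub_ge (ℓ := ℓ) (t := t) hℓ0 hζ
  -- (2) Hadamard: `H = Re ζ'/ζ(s₁) + Re 1/(s₁−1) − ½ log π + ½ Re ψ(s₁/2+1)`
  have hHad := re_neg_logDeriv_zeta_hadamard (s := s₁) (by rw [hs₁re]; linarith) hs₁0 hs₁1 hζ
  -- (3) explicit formula at `s₁` and the zero sum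
  have hEF := SelbergExplicit.explicit_formula hℓ0 (s := s₁) (by rw [hs₁re]; linarith)
    (by rw [hs₁re]; linarith) hs₁1 hζ
  have hZ : ‖∑' ρ : RHWave0.riemannZetaNontrivialZeros,
      (riemannZetaZeroOrder (ρ : ℂ) : ℂ) * SelbergExplicit.zeroTerm ℓ s₁ ρ‖ ≤ eps (δ * ℓ) * W ℓ t := by
    have h := norm_tsum_zeroTerm_le (ℓ := ℓ) (t := t) (σ := 1 / 2 + δ) hℓ1 (by rw [← hδ])
    rw [← hδ, show (1 / 2 + δ - 1 / 2 - δ) * ℓ = 0 by ring, neg_zero, Real.exp_zero, mul_one] at h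
    exact h
  have heps : eps (δ * ℓ) ≤ 3 / 10 := eps_le hu
  have hW0 : 0 ≤ W ℓ t := W_nonneg ℓ t hℓ0
  have hZ' : ‖∑' ρ : RHWave0.riemannZetaNontrivialZeros,
      (riemannZetaZeroOrder (ρ : ℂ) : ℂ) * SelbergExplicit.zeroTerm ℓ s₁ ρ‖ ≤ 3 / 10 * W ℓ t :=
    hZ.trans (mul_le_mul_of_nonneg_right heps hW0)
  -- (4) the small terms
  have hT1 : ‖SelbergExplicit.zeroTerm ℓ s₁ 1‖ ≤ 1 := by
    have := norm_zeroTerm_one_le (δ := δ) hℓ0 ht1.le hℓt hδ0.le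
    refine this.trans ?_
    rw [div_le_one (by positivity)]; nlinarith
  have hJ : ‖SelbergExplicit.remainder ℓ s₁‖ ≤ 3 * CJ * Real.log t := by
    have h := hCJ ℓ hℓ0 s₁ (by rw [hs₁re]; linarith)
    rw [hs₁re, hs₁im] at h
    refine h.trans ?_
    have hlog0 : 0 ≤ Real.log (1 + |t|) := Real.log_nonneg (by linarith [abs_nonneg t])
    have hlog1 : Real.log (1 + |t|) ≤ Real.log 2 + Real.log t := by
      rw [abs_of_pos ht0, ← Real.log_mul (by norm_num) ht0.ne']
      exact Real.log_le_log (by linarith) (by linarith)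
    have hlog2 : Real.log 2 ≤ 1 := by
      have := Real.log_two_lt_d9; linarith
    set X : ℝ := CJ * (1 + Real.log (1 + |t|)) with hX
    have hX0 : 0 ≤ X := by positivity
    have he : Real.exp (-(ℓ * (1 / 2 + δ + 1 / 2))) ≤ 1 := by
      rw [Real.exp_le_one_iff]; nlinarith
    have hℓ2 : 1 ≤ ℓ ^ 2 := by nlinarith
    calc X * Real.exp (-(ℓ * (1 / 2 + δ + 1 / 2))) / ℓ ^ 2
        ≤ X * Real.exp (-(ℓ * (1 / 2 + δ + 1 / 2))) := div_le_self (by positivity) hℓ2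
      _ ≤ X := mul_le_of_le_one_right hX0 he
      _ ≤ CJ * (3 * Real.log t) := by rw [hX]; gcongr; linarith
      _ = 3 * CJ * Real.log t := by ring
  have hP : |(1 / (s₁ - 1)).re| ≤ 1 := by
    refine (Complex.abs_re_le_norm _).trans ?_
    rw [norm_div, norm_one, div_le_one (norm_pos_iff.2 (sub_ne_zero.2 hs₁1))]
    have := Complex.abs_im_le_norm (s₁ - 1)
    have him : (s₁ - 1).im = t := by simp [hs₁]
    rw [him, abs_of_pos ht0] at this
    linarith
  have hψ : ‖Complex.digamma (s₁ / 2 + 1)‖ ≤ Real.log t + 9 := by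
    have hre' : (s₁ / 2 + 1).re = (1 / 2 + δ) / 2 + 1 := by simp [hs₁]
    have him' : (s₁ / 2 + 1).im = t / 2 := by simp [hs₁]
    have hre : 0 < (s₁ / 2 + 1).re := by rw [hre']; positivity
    have him : 1 / 2 ≤ |(s₁ / 2 + 1).im| := by rw [him', abs_of_pos (by positivity)]; linarith
    have h := Literature.Analysis.SpecialFunctions.Complex.norm_digamma_le_log hre him
    refine h.trans ?_
    have hn : ‖s₁ / 2 + 1‖ ≤ t := by
      refine (Complex.norm_le_abs_re_add_abs_im _).trans ?_
      rw [hre', him', abs_of_pos (by positivity), abs_of_pos (by positivity)]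
      linarith
    have : Real.log (1 + ‖s₁ / 2 + 1‖) ≤ Real.log 2 + Real.log t := by
      rw [← Real.log_mul (by norm_num) ht0.ne']
      exact Real.log_le_log (by positivity) (by linarith)
    have hlog2 : Real.log 2 ≤ 1 := by have := Real.log_two_lt_d9; linarith
    linarith
  have hπ : Real.log π / 2 ≤ 1 := by
    have : Real.log π ≤ 2 := by
      have h4 : π ≤ 4 := Real.pi_le_four
      calc Real.log π ≤ Real.log 4 := Real.log_le_log Real.pi_pos h4
        _ = 2 * Real.log 2 := by rw [show (4 : ℝ) = 2 ^ 2 by norm_num, Real.log_pow]; ring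
        _ ≤ 2 := by have := Real.log_two_lt_d9; linarith
    linarith
  -- (5) `Re ζ'/ζ(s₁) ≤ ‖D‖ + 1 + (3/10) W + 3 C_J log t`
  set D := fordK (SelbergExplicit.smoothing ℓ) s₁ with hD
  set Zs := ∑' ρ : RHWave0.riemannZetaNontrivialZeros,
      (riemannZetaZeroOrder (ρ : ℂ) : ℂ) * SelbergExplicit.zeroTerm ℓ s₁ ρ with hZs
  have hReζ : (deriv riemannZeta s₁ / riemannZeta s₁).re ≤
      ‖D‖ + 1 + 3 / 10 * W ℓ t + 3 * CJ * Real.log t := by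
    rw [hEF]
    refine (Complex.re_le_norm _).trans ?_
    have e1 : ‖-D - SelbergExplicit.zeroTerm ℓ s₁ 1 + Zs + SelbergExplicit.remainder ℓ s₁‖ ≤
        ‖-D - SelbergExplicit.zeroTerm ℓ s₁ 1 + Zs‖ + ‖SelbergExplicit.remainder ℓ s₁‖ := norm_add_le _ _
    have e2 : ‖-D - SelbergExplicit.zeroTerm ℓ s₁ 1 + Zs‖ ≤ ‖-D - SelbergExplicit.zeroTerm ℓ s₁ 1‖ + ‖Zs‖ :=
      norm_add_le _ _
    have e3 : ‖-D - SelbergExplicit.zeroTerm ℓ s₁ 1‖ ≤ ‖D‖ + ‖SelbergExplicit.zeroTerm ℓ s₁ 1‖ := by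
      have := norm_sub_le (-D) (SelbergExplicit.zeroTerm ℓ s₁ 1)
      rwa [norm_neg] at this
    linarith
  -- (6) combine
  have hHeq : ∑' ρ : RHWave0.riemannZetaNontrivialZeros,
      (riemannZetaZeroOrder (ρ : ℂ) : ℝ) * (1 / (s₁ - ρ)).re =
      (deriv riemannZeta s₁ / riemannZeta s₁).re + (1 / (s₁ - 1)).re - Real.log π / 2 +
        (Complex.digamma (s₁ / 2 + 1)).re / 2 := by
    have e : (-(deriv riemannZeta s₁ / riemannZeta s₁)).re = -(deriv riemannZeta s₁ / riemannZeta s₁).re := by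
      simp
    rw [e] at hHad
    linarith
  have hψre : (Complex.digamma (s₁ / 2 + 1)).re ≤ Real.log t + 9 := (Complex.re_le_norm _).trans hψ
  have hPre : (1 / (s₁ - 1)).re ≤ 1 := (le_abs_self _).trans hP
  have hlogπ : 0 ≤ Real.log π := Real.log_nonneg (by linarith [Real.pi_gt_three])
  have hmain : 12 / 25 * W ℓ t ≤ ‖D‖ + 3 / 10 * W ℓ t + (3 * CJ + 3) * Real.log t := by
    have h1 := hH.trans_eq hHeq
    linarith
  have hD0 := norm_nonneg D
  linarith

end SelbergSigma

end Literature.NumberTheory.LFunctions
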